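import Literature.NumberTheory.LFunctions.KloostermanFractionsFromCbTools
import HarnessLib

/-!
# Bilinear forms with Kloosterman fractions: tools for §6 with the `O`-family

Topic `NumberTheory/LFunctions`.  The `O`-family analogues of `BC_terms52_le` and `BC_sqrtb_Cb_le`
of `KloostermanFractionsFromCbTools.lean` (S. Bettin, V. Chandee, Adv. Math. 328 (2018), §6):
the six terms `b^{1/5}M^{6/5}N'^{7/10} + b^{1/2}M^{3/4}N'^{19/16} + b^{3/10}M^{4/5}N'^{4/5} +
b^{1/2}M^{1/2}N'^{9/8} + b^{1/2}N'^{7/4} + b^{1/2}N'^{3/2}` (from the tree's explicit off-diagonal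
bound, `KloostermanFractionsFrom51O.lean`) at `N' = N/b`, times `b^{1/2}` (`BC_termsO_le`), and the
per-`b` bound (`BC_sqrtb_CbO_le`).

## References

* S. Bettin, V. Chandee, Adv. Math. 328 (2018) 1234–1262 (arXiv:1502.00769), §6 (6.1)–(6.2).
  [BettinChandee2018]
-/

noncomputable section

open Finset

namespace Literature.NumberTheory.LFunctions

/-- **(5.2'') at `N' = N/b`, times `b^{1/2}`** (the `O`-family analogue of `BC_terms52_le`; here all
`b`-exponents are `≤ 0`, so no restriction `b ≤ N^{1/2}` is needed): for `M, N > 0`, `b ≥ 1`,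
`b^{1/2}(b^{1/5}M^{6/5}N'^{7/10} + b^{1/2}M^{3/4}N'^{19/16} + b^{3/10}M^{4/5}N'^{4/5} + b^{1/2}M^{1/2}N'^{9/8} + b^{1/2}N'^{7/4} + b^{1/2}N'^{3/2})`
`≤ M^{6/5}N^{7/10} + M^{3/4}N^{19/16} + M^{4/5}N^{4/5} + M^{1/2}N^{9/8} + N^{7/4} + N^{3/2}`, `N' = N/b`.
[cite: BettinChandee2018, §6 (6.1)] -/
theorem BC_termsO_le {M N b : ℝ} (hM : 0 < M) (hN : 0 < N) (hb1 : 1 ≤ b) :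
    Real.sqrt b * ((b : ℝ) ^ (1 / 5 : ℝ) * M ^ (6 / 5 : ℝ) * (N / b) ^ (7 / 10 : ℝ) +
        (b : ℝ) ^ (1 / 2 : ℝ) * M ^ (3 / 4 : ℝ) * (N / b) ^ (19 / 16 : ℝ) +
        (b : ℝ) ^ (3 / 10 : ℝ) * M ^ (4 / 5 : ℝ) * (N / b) ^ (4 / 5 : ℝ) +
        (b : ℝ) ^ (1 / 2 : ℝ) * M ^ (1 / 2 : ℝ) * (N / b) ^ (9 / 8 : ℝ) +
        (b : ℝ) ^ (1 / 2 : ℝ) * (N / b) ^ (7 / 4 : ℝ) + (b : ℝ) ^ (1 / 2 : ℝ) * (N / b) ^ (3 / 2 : ℝ)) ≤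
      M ^ (6 / 5 : ℝ) * N ^ (7 / 10 : ℝ) + M ^ (3 / 4 : ℝ) * N ^ (19 / 16 : ℝ) + M ^ (4 / 5 : ℝ) * N ^ (4 / 5 : ℝ) +
        M ^ (1 / 2 : ℝ) * N ^ (9 / 8 : ℝ) + N ^ (7 / 4 : ℝ) + N ^ (3 / 2 : ℝ) := by
  have hb : 0 < b := by linarith
  have hNb : 0 < N / b := div_pos hN hb
  obtain ⟨a, ha⟩ : ∃ a : ℝ, a = Real.log M := ⟨_, rfl⟩
  obtain ⟨n, hn⟩ : ∃ n : ℝ, n = Real.log N := ⟨_, rfl⟩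
  obtain ⟨l, hl⟩ : ∃ l : ℝ, l = Real.log b := ⟨_, rfl⟩
  have hl0 : 0 ≤ l := hl ▸ Real.log_nonneg hb1
  have eM : ∀ c : ℝ, M ^ c = Real.exp (c * a) := fun c => by
    rw [Real.rpow_def_of_pos hM, mul_comm, ha]
  have eN : ∀ c : ℝ, N ^ c = Real.exp (c * n) := fun c => by
    rw [Real.rpow_def_of_pos hN, mul_comm, hn]
  have eb : ∀ c : ℝ, b ^ c = Real.exp (c * l) := fun c => by
    rw [Real.rpow_def_of_pos hb, mul_comm, hl]
  have eNb : ∀ c : ℝ, (N / b) ^ c = Real.exp (c * (n - l)) := fun c => by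
    rw [Real.rpow_def_of_pos hNb, Real.log_div hN.ne' hb.ne', mul_comm, hn, hl]
  have esb : Real.sqrt b = Real.exp (1 / 2 * l) := by rw [Real.sqrt_eq_rpow, eb]
  simp only [esb, eb, eM, eN, eNb]
  have t1 : Real.exp (1 / 2 * l) * (Real.exp (1 / 5 * l) * Real.exp (6 / 5 * a) * Real.exp (7 / 10 * (n - l))) ≤
      Real.exp (6 / 5 * a) * Real.exp (7 / 10 * n) := by
    rw [← Real.exp_add, ← Real.exp_add, ← Real.exp_add, ← Real.exp_add]
    exact Real.exp_le_exp.mpr (by linarith)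
  have t2 : Real.exp (1 / 2 * l) * (Real.exp (1 / 2 * l) * Real.exp (3 / 4 * a) * Real.exp (19 / 16 * (n - l))) ≤
      Real.exp (3 / 4 * a) * Real.exp (19 / 16 * n) := by
    rw [← Real.exp_add, ← Real.exp_add, ← Real.exp_add, ← Real.exp_add]
    exact Real.exp_le_exp.mpr (by linarith)
  have t3 : Real.exp (1 / 2 * l) * (Real.exp (3 / 10 * l) * Real.exp (4 / 5 * a) * Real.exp (4 / 5 * (n - l))) ≤
      Real.exp (4 / 5 * a) * Real.exp (4 / 5 * n) := by
    rw [← Real.exp_add, ← Real.exp_add, ← Real.exp_add, ← Real.exp_add]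
    exact Real.exp_le_exp.mpr (by linarith)
  have t4 : Real.exp (1 / 2 * l) * (Real.exp (1 / 2 * l) * Real.exp (1 / 2 * a) * Real.exp (9 / 8 * (n - l))) ≤
      Real.exp (1 / 2 * a) * Real.exp (9 / 8 * n) := by
    rw [← Real.exp_add, ← Real.exp_add, ← Real.exp_add, ← Real.exp_add]
    exact Real.exp_le_exp.mpr (by linarith)
  have t5 : Real.exp (1 / 2 * l) * (Real.exp (1 / 2 * l) * Real.exp (7 / 4 * (n - l))) ≤
      Real.exp (7 / 4 * n) := by
    rw [← Real.exp_add, ← Real.exp_add]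
    exact Real.exp_le_exp.mpr (by linarith)
  have t6 : Real.exp (1 / 2 * l) * (Real.exp (1 / 2 * l) * Real.exp (3 / 2 * (n - l))) ≤
      Real.exp (3 / 2 * n) := by
    rw [← Real.exp_add, ← Real.exp_add]
    exact Real.exp_le_exp.mpr (by linarith)
  linarith [t1, t2, t3, t4, t5, t6]

/-- **One squarefull `b`** (the two cases `b ≤ N^{1/2}` — hypothesis (5.2) at `N' = N/b` — and
`b > N^{1/2}` — the trivial bound — of Bettin–Chandee §6): for `γ` supported where
`γ_{n'} ≠ 0 ⇒ n'` squarefree, `(n', b) = 1`, `β_{bn'} ≠ 0` (e.g. `γ = β_b`),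
`b^{1/2} ∑_{M<m≤2M,(m,b)=1} |kfInner k b (N/b) γ m|² ≤ ‖γ‖² (K (MN(1+|k|))^ε (1+|k|/MN)^{1/2} T₆(M,N) + 4MN^{3/4})`,
`T₆ = MN^{3/4} + M^{1/2}N^{5/4} + M^{6/5}N^{1/10} + M^{6/5}N^{7/10} + M^{3/5}N^{13/10} + N^{7/4}`.
[cite: BettinChandee2018, §6 (6.1)–(6.2)] -/
theorem BC_sqrtb_CbO_le {ε K M N : ℝ} (hK : 0 < K) (hM : 1 / 2 ≤ M) (hN : 1 / 2 ≤ N)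
    {k : ℤ} (hk : k ≠ 0) {β : ℕ → ℂ}
    (hβ : ∀ n : ℕ, β n ≠ 0 → N < n ∧ (n : ℝ) ≤ 2 * N)
    (hβk : ∀ n : ℕ, β n ≠ 0 → n.Coprime k.natAbs)
    (h5 : ∀ (b : ℕ), 0 < b → (∀ p ∈ b.primeFactors, p ^ 2 ∣ b) →
      ∀ (M N' : ℝ), 1 / 2 ≤ M → 1 / 2 ≤ N' → (b : ℝ) ≤ N' → ∀ (k : ℤ), k ≠ 0 → b.Coprime k.natAbs →
      ∀ (γ : ℕ → ℂ),
        (∀ n : ℕ, γ n ≠ 0 → N' < n ∧ (n : ℝ) ≤ 2 * N') →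
        (∀ n : ℕ, γ n ≠ 0 → Squarefree n ∧ n.Coprime b ∧ n.Coprime k.natAbs) →
        ∑ m ∈ (Ioc ⌊M⌋₊ ⌊2 * M⌋₊).filter (fun m => m.Coprime b), ‖kfInner k b N' γ m‖ ^ 2 ≤
          K * (∑ n ∈ Icc 1 ⌊2 * N'⌋₊, ‖γ n‖ ^ 2) *
          ((b : ℝ) * M * N' * (1 + |(k : ℝ)|)) ^ ε * (1 + |(k : ℝ)| / ((b : ℝ) * N' * M)) ^ (1 / 2 : ℝ) *
          ((b : ℝ) ^ (1 / 5 : ℝ) * M ^ (6 / 5 : ℝ) * N' ^ (7 / 10 : ℝ) +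
            (b : ℝ) ^ (1 / 2 : ℝ) * M ^ (3 / 4 : ℝ) * N' ^ (19 / 16 : ℝ) +
            (b : ℝ) ^ (3 / 10 : ℝ) * M ^ (4 / 5 : ℝ) * N' ^ (4 / 5 : ℝ) +
            (b : ℝ) ^ (1 / 2 : ℝ) * M ^ (1 / 2 : ℝ) * N' ^ (9 / 8 : ℝ) +
            (b : ℝ) ^ (1 / 2 : ℝ) * N' ^ (7 / 4 : ℝ) + (b : ℝ) ^ (1 / 2 : ℝ) * N' ^ (3 / 2 : ℝ)))
    {b : ℕ} (hb1 : 1 ≤ b) (hbfull : ∀ p ∈ b.primeFactors, p ^ 2 ∣ b) (γ : ℕ → ℂ)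
    (hsupp : ∀ n' : ℕ, γ n' ≠ 0 → Squarefree n' ∧ n'.Coprime b ∧ β (b * n') ≠ 0) :
    Real.sqrt b * ∑ m ∈ (Ioc ⌊M⌋₊ ⌊2 * M⌋₊).filter (fun m => m.Coprime b), ‖kfInner k b (N / b) γ m‖ ^ 2 ≤
      (∑ n' ∈ Icc 1 ⌊2 * (N / b)⌋₊, ‖γ n'‖ ^ 2) *
        (K * (M * N * (1 + |(k : ℝ)|)) ^ ε * (1 + |(k : ℝ)| / (M * N)) ^ (1 / 2 : ℝ) *
          (M ^ (6 / 5 : ℝ) * N ^ (7 / 10 : ℝ) + M ^ (3 / 4 : ℝ) * N ^ (19 / 16 : ℝ) + M ^ (4 / 5 : ℝ) * N ^ (4 / 5 : ℝ) +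
            M ^ (1 / 2 : ℝ) * N ^ (9 / 8 : ℝ) + N ^ (7 / 4 : ℝ) + N ^ (3 / 2 : ℝ)) +
          4 * (M * N ^ (3 / 4 : ℝ))) := by
  have hM0 : 0 < M := by linarith
  have hN0 : 0 < N := by linarith
  have hb0 : 0 < b := hb1
  have hbr : (0 : ℝ) < b := by exact_mod_cast hb0
  have hbr1 : (1 : ℝ) ≤ b := by exact_mod_cast hb1
  have hQ0 : 0 < M * N := mul_pos hM0 hN0
  have hkk0 : 0 < 1 + |(k : ℝ)| := by positivity
  have hW0 : 0 < 1 + |(k : ℝ)| / (M * N) := by positivity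
  -- notation for the pieces (opaque abbreviations)
  obtain ⟨nb2, hnb2⟩ : ∃ x : ℝ, x = ∑ n' ∈ Icc 1 ⌊2 * (N / b)⌋₊, ‖γ n'‖ ^ 2 := ⟨_, rfl⟩
  have hnb0 : 0 ≤ nb2 := by rw [hnb2]; exact Finset.sum_nonneg fun _ _ => sq_nonneg _
  obtain ⟨Cb, hCb⟩ : ∃ x : ℝ,
      x = ∑ m ∈ (Ioc ⌊M⌋₊ ⌊2 * M⌋₊).filter (fun m => m.Coprime b), ‖kfInner k b (N / b) γ m‖ ^ 2 := ⟨_, rfl⟩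
  have hCb0 : 0 ≤ Cb := by rw [hCb]; exact Finset.sum_nonneg fun _ _ => sq_nonneg _
  obtain ⟨T6, hT6⟩ : ∃ T6 : ℝ, T6 = M ^ (6 / 5 : ℝ) * N ^ (7 / 10 : ℝ) + M ^ (3 / 4 : ℝ) * N ^ (19 / 16 : ℝ) +
      M ^ (4 / 5 : ℝ) * N ^ (4 / 5 : ℝ) + M ^ (1 / 2 : ℝ) * N ^ (9 / 8 : ℝ) + N ^ (7 / 4 : ℝ) + N ^ (3 / 2 : ℝ) := ⟨_, rfl⟩
  have hT60 : 0 ≤ T6 := by rw [hT6]; positivity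
  obtain ⟨E, hE⟩ : ∃ E : ℝ, E = K * (M * N * (1 + |(k : ℝ)|)) ^ ε * (1 + |(k : ℝ)| / (M * N)) ^ (1 / 2 : ℝ) := ⟨_, rfl⟩
  have hE0 : 0 ≤ E := by rw [hE]; positivity
  have hMN34 : 0 ≤ 4 * (M * N ^ (3 / 4 : ℝ)) := by positivity
  -- restate the goal with the abbreviations
  suffices hgoal : Real.sqrt b * Cb ≤ nb2 * (E * T6 + 4 * (M * N ^ (3 / 4 : ℝ))) by
    rw [hCb, hnb2, hE, hT6] at hgoal; exact hgoal
  by_cases hsqrtN : (b : ℝ) ≤ N ^ (1 / 2 : ℝ)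
  · -- `b ≤ N^{1/2}`: the hypothesis (5.2), unless `γ = 0`
    by_cases hne : ∃ n' : ℕ, γ n' ≠ 0
    · obtain ⟨n₀, hn₀⟩ := hne
      obtain ⟨_, _, hβn₀⟩ := hsupp n₀ hn₀
      have hbk : b.Coprime k.natAbs :=
        Nat.Coprime.coprime_dvd_left (Dvd.intro _ rfl) (hβk (b * n₀) hβn₀)
      have hNb : 1 / 2 ≤ N / b := by
        have h1 := (hβ (b * n₀) hβn₀).2
        have hn₀1 : (1 : ℝ) ≤ n₀ := by
          have : n₀ ≠ 0 := by
            rintro rfl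
            simp only [mul_zero] at hβn₀
            have := (hβ 0 hβn₀).1
            simp at this
            linarith
          exact_mod_cast Nat.one_le_iff_ne_zero.mpr this
        rw [le_div_iff₀ hbr]
        push_cast at h1
        nlinarith
      have hγ1 : ∀ n' : ℕ, γ n' ≠ 0 → N / b < n' ∧ (n' : ℝ) ≤ 2 * (N / b) := by
        intro n' hn'
        obtain ⟨_, _, hβn'⟩ := hsupp n' hn'
        obtain ⟨h1, h2⟩ := hβ (b * n') hβn'
        push_cast at h1 h2
        constructor
        · rw [div_lt_iff₀ hbr]; linarith
        · rw [show 2 * (N / b) = 2 * N / b by ring, le_div_iff₀ hbr]; linarith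
      have hγ2 : ∀ n' : ℕ, γ n' ≠ 0 → Squarefree n' ∧ n'.Coprime b ∧ n'.Coprime k.natAbs := by
        intro n' hn'
        obtain ⟨hsqf, hcop, hβn'⟩ := hsupp n' hn'
        exact ⟨hsqf, hcop, Nat.Coprime.coprime_dvd_left (Dvd.intro_left _ rfl) (hβk (b * n') hβn')⟩
      have hbN' : (b : ℝ) ≤ N / b := by
        have h2 : (b : ℝ) * b ≤ N := by
          have := mul_le_mul hsqrtN hsqrtN hbr.le (by positivity)
          rwa [← Real.sqrt_eq_rpow, Real.mul_self_sqrt hN0.le] at this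
        rw [le_div_iff₀ hbr]; linarith
      have h := h5 b hb0 hbfull M (N / b) hM hNb hbN' k hk hbk γ hγ1 hγ2
      -- simplify `b M (N/b) (1+|k|) = MN(1+|k|)`, `1 + |k|/(b (N/b) M) = 1 + |k|/(MN)`
      have e1 : (b : ℝ) * M * (N / b) * (1 + |(k : ℝ)|) = M * N * (1 + |(k : ℝ)|) := by field_simp
      have e2 : 1 + |(k : ℝ)| / ((b : ℝ) * (N / b) * M) = 1 + |(k : ℝ)| / (M * N) := by
        rw [mul_div_cancel₀ _ hbr.ne', mul_comm N M]
      rw [e1, e2, ← hnb2, ← hCb] at h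
      have h' : Cb ≤ nb2 * E *
          ((b : ℝ) ^ (1 / 5 : ℝ) * M ^ (6 / 5 : ℝ) * (N / b) ^ (7 / 10 : ℝ) +
            (b : ℝ) ^ (1 / 2 : ℝ) * M ^ (3 / 4 : ℝ) * (N / b) ^ (19 / 16 : ℝ) +
            (b : ℝ) ^ (3 / 10 : ℝ) * M ^ (4 / 5 : ℝ) * (N / b) ^ (4 / 5 : ℝ) +
            (b : ℝ) ^ (1 / 2 : ℝ) * M ^ (1 / 2 : ℝ) * (N / b) ^ (9 / 8 : ℝ) +
            (b : ℝ) ^ (1 / 2 : ℝ) * (N / b) ^ (7 / 4 : ℝ) + (b : ℝ) ^ (1 / 2 : ℝ) * (N / b) ^ (3 / 2 : ℝ)) := by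
        rw [hE]; calc _ ≤ _ := h
          _ = _ := by ring
      have h52le : Real.sqrt b * ((b : ℝ) ^ (1 / 5 : ℝ) * M ^ (6 / 5 : ℝ) * (N / b) ^ (7 / 10 : ℝ) +
            (b : ℝ) ^ (1 / 2 : ℝ) * M ^ (3 / 4 : ℝ) * (N / b) ^ (19 / 16 : ℝ) +
            (b : ℝ) ^ (3 / 10 : ℝ) * M ^ (4 / 5 : ℝ) * (N / b) ^ (4 / 5 : ℝ) +
            (b : ℝ) ^ (1 / 2 : ℝ) * M ^ (1 / 2 : ℝ) * (N / b) ^ (9 / 8 : ℝ) +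
            (b : ℝ) ^ (1 / 2 : ℝ) * (N / b) ^ (7 / 4 : ℝ) + (b : ℝ) ^ (1 / 2 : ℝ) * (N / b) ^ (3 / 2 : ℝ)) ≤ T6 := by
        rw [hT6]; exact BC_termsO_le hM0 hN0 hbr1
      have hnE : 0 ≤ nb2 * E := mul_nonneg hnb0 hE0
      calc Real.sqrt b * Cb
          ≤ Real.sqrt b * (nb2 * E *
            ((b : ℝ) ^ (1 / 5 : ℝ) * M ^ (6 / 5 : ℝ) * (N / b) ^ (7 / 10 : ℝ) +
            (b : ℝ) ^ (1 / 2 : ℝ) * M ^ (3 / 4 : ℝ) * (N / b) ^ (19 / 16 : ℝ) +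
            (b : ℝ) ^ (3 / 10 : ℝ) * M ^ (4 / 5 : ℝ) * (N / b) ^ (4 / 5 : ℝ) +
            (b : ℝ) ^ (1 / 2 : ℝ) * M ^ (1 / 2 : ℝ) * (N / b) ^ (9 / 8 : ℝ) +
            (b : ℝ) ^ (1 / 2 : ℝ) * (N / b) ^ (7 / 4 : ℝ) + (b : ℝ) ^ (1 / 2 : ℝ) * (N / b) ^ (3 / 2 : ℝ))) :=
            mul_le_mul_of_nonneg_left h' (Real.sqrt_nonneg _)
        _ = nb2 * E * (Real.sqrt b *
            ((b : ℝ) ^ (1 / 5 : ℝ) * M ^ (6 / 5 : ℝ) * (N / b) ^ (7 / 10 : ℝ) +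
            (b : ℝ) ^ (1 / 2 : ℝ) * M ^ (3 / 4 : ℝ) * (N / b) ^ (19 / 16 : ℝ) +
            (b : ℝ) ^ (3 / 10 : ℝ) * M ^ (4 / 5 : ℝ) * (N / b) ^ (4 / 5 : ℝ) +
            (b : ℝ) ^ (1 / 2 : ℝ) * M ^ (1 / 2 : ℝ) * (N / b) ^ (9 / 8 : ℝ) +
            (b : ℝ) ^ (1 / 2 : ℝ) * (N / b) ^ (7 / 4 : ℝ) + (b : ℝ) ^ (1 / 2 : ℝ) * (N / b) ^ (3 / 2 : ℝ))) := by ring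
        _ ≤ nb2 * E * T6 := mul_le_mul_of_nonneg_left h52le hnE
        _ ≤ nb2 * (E * T6 + 4 * (M * N ^ (3 / 4 : ℝ))) := by
            have : 0 ≤ nb2 * (4 * (M * N ^ (3 / 4 : ℝ))) := mul_nonneg hnb0 hMN34
            nlinarith
    · -- `γ = 0`: the second moment vanishes
      push Not at hne
      have h0 : Cb = 0 := by
        rw [hCb]
        refine Finset.sum_eq_zero fun m _ => ?_
        rw [kfInner_eq_zero_of_forall k b (N / b) (fun n _ => hne n) m, norm_zero]
        simp
      rw [h0, mul_zero]
      exact mul_nonneg hnb0 (add_nonneg (mul_nonneg hE0 hT60) hMN34)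
  · -- `b > N^{1/2}`: the trivial bound
    have hbN : N ^ (1 / 2 : ℝ) < b := not_le.mp hsqrtN
    have h1 : Cb ≤ 4 * M * (N / b) * nb2 := by
      rw [hCb, hnb2]; exact kfCI_trivial_bound k b hM0.le (div_pos hN0 hbr).le γ
    -- `√b · 4M(N/b) = 4MN/√b ≤ 4 M N^{3/4}`
    have hsqb : Real.sqrt b * (4 * M * (N / b)) ≤ 4 * (M * N ^ (3 / 4 : ℝ)) := by
      have hsb : 0 < Real.sqrt b := Real.sqrt_pos.mpr hbr
      have e : Real.sqrt b * (4 * M * (N / b)) = 4 * M * N / Real.sqrt b := by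
        rw [eq_div_iff hsb.ne']
        calc Real.sqrt b * (4 * M * (N / b)) * Real.sqrt b = 4 * M * N * (Real.sqrt b * Real.sqrt b / b) := by
              ring
          _ = 4 * M * N := by rw [Real.mul_self_sqrt hbr.le, div_self hbr.ne', mul_one]
      rw [e, div_le_iff₀ hsb]
      have h2 : N ^ (1 / 4 : ℝ) ≤ Real.sqrt b := by
        rw [Real.sqrt_eq_rpow]
        calc N ^ (1 / 4 : ℝ) = (N ^ (1 / 2 : ℝ)) ^ (1 / 2 : ℝ) := by
              rw [← Real.rpow_mul hN0.le]; norm_num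
          _ ≤ (b : ℝ) ^ (1 / 2 : ℝ) := Real.rpow_le_rpow (by positivity) hbN.le (by norm_num)
      have h3 : N = N ^ (3 / 4 : ℝ) * N ^ (1 / 4 : ℝ) := by
        rw [← Real.rpow_add hN0]; norm_num
      calc 4 * M * N = 4 * (M * N ^ (3 / 4 : ℝ)) * N ^ (1 / 4 : ℝ) := by
            conv_lhs => rw [h3]
            ring
        _ ≤ 4 * (M * N ^ (3 / 4 : ℝ)) * Real.sqrt b := by gcongr
    calc Real.sqrt b * Cb ≤ Real.sqrt b * (4 * M * (N / b) * nb2) :=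
          mul_le_mul_of_nonneg_left h1 (Real.sqrt_nonneg _)
      _ = (Real.sqrt b * (4 * M * (N / b))) * nb2 := by ring
      _ ≤ 4 * (M * N ^ (3 / 4 : ℝ)) * nb2 := mul_le_mul_of_nonneg_right hsqb hnb0
      _ ≤ nb2 * (E * T6 + 4 * (M * N ^ (3 / 4 : ℝ))) := by
          have : 0 ≤ nb2 * (E * T6) := mul_nonneg hnb0 (mul_nonneg hE0 hT60)
          nlinarith

end Literature.NumberTheory.LFunctions

end
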